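import Summits.QuantumFields.YangMills.Theorems.UnitScaleTiltProp8HalvingELJunction
import Summits.QuantumFields.YangMills.Theorems.UnitScaleTiltProp8ChartHInvComb
import HarnessLib

/-!
# Route `UnitScaleTilt`, crux K1 child «MinimiserStabilityRegPr» (stmt-QuantumFields-19200), registered stub V2′ `stub_halvingStep`
# (skeletons v8 5b4e846794b80374 / v10 `BirthV10`) — **THE E–L DERIVATION (127) ⟹ (158) FOR THE `𝔤`-VALUED CHART FIELD WITH P2'S OPERATORS** (owner socket (σ-3),
# file 7 — the converse companion of `HalvingELJunction`): if the chart field `A′` satisfies the WEAK EULER–LAGRANGE EQUATION on the constraint surface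
# (`⟨∂δ, ∂A′⟩ + ⟨δ, W⟩ = 0` for every real test field `δ` with `Qδ = 0`, read on every `ℝ`-linear component — print's (127) at background 1, `J = 0`) and the residual
# Landau slice `R∂*A′ = 0` ((126)/(153)), then `A₁ := A′ − H(QA′)` solves [Balaban1985Variational] (158) `A₁ + G̃W = 0` with P2's pinned `H = GQ*(QGQ*)⁻¹`, `G̃ = G − HQG`
# extended to `𝔤`-valued fields through their kernels — LITERALLY the `hsol` hypothesis of `HalvingA1Row165.row165_of_smallSolution(_layer)` ∕ `HalvingA1Row165EL.row165_of_slice`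
# with `𝔄 = H(QA′)`

Cell `ym3-torus` (HUMAN RULING D-0037, YM ladder rung R3 — continuum SU(2) YM₃ on the torus is a RUNG, not the Clay problem), width seat
`ym-ust-19200-w3` gen 3 (D-0149).  `--supports stmt-QuantumFields-19200 --as helper`; def-free, 0 sorry, standard axioms.

THE PRINT ([Balaban1985Variational] pp. 297–300): *«⟨δA′, J⟩ + ⟨δA′, ΔA′₁⟩ + ⟨δA′, (δ/δA′)V(A′₁)⟩ = 0 (127) for all δA′ satisfying QδA′ = 0. The configuration A′₁ satisfies
RD*A′₁ = 0, hence … Δ_a … (128) … We decompose A′₁ = A₀ + H₀B … By the definition of H₀B and the condition QδA′ = 0 we have ⟨δA′, Δ_aH₀B⟩ = 0 … A₀ = −GP₀*J + …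
(133) … GP₀* = G̃, hence … (143) … A₁ + G̃((δ/δA′)V)(A₁ + HB) = 0. (158)»*.  F4's `FlatCriticalEquation143.eq143_of_critical` is this derivation over ABSTRACT real matrices;
THIS FILE is the same derivation in P2's CONCRETE letters (`B6SectAOperatorsV1`/`B6SectAVectorModelV1`, `FlatCubeOperators`) for `𝔤`-valued fields through their real
readings, producing the kernel-extension form the halving package consumes.

WHAT THIS FILE PROVES (no definition, no sorry):
* §1 (model, every `D : Domains P`, `c ≠ 0`, `w > 0`): `inner_dcsE_dcE_hOp_eq_zero_of_ker` (`Qδ = 0 ⇒ ⟨∂δ, ∂(Hβ)⟩ = 0` — from `Δ_aH = Q*E`, `R∂*H = 0`, `QH = 1`),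
  **`sub_hOp_eq_neg_Gt_of_weakEL`** (weak E–L on `ker Q` + slice ⇒ `x′ − H(Qx′) = −G̃f`, by `FlatCubeOperators.eq_Gt_of_ker`).
* §2 (T³ carrier, EVERY nested family `D : Domains (F.P K)`, P2's pinned `flatH`/`IsFlatGt`): `QE_reading` (`Q(φ∘A′) = φ∘(QA′)` for the matrix-valued block average),
  **`sol158_of_weakEL`**: for `𝔤`-valued `A′`, `Wc` with the weak E–L per reading and the slice per reading, `𝔄 := Σ_c (He_c)·(QA′)(c)`, `𝒢 := Σ_{b′} (G̃e_{b′})·Wc(b′)`: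
  `(A′ − 𝔄) + 𝒢 = 0` — i.e. `A₁ + G(W(A₁ + 𝔄)) = 0` with `A₁ := A′ − 𝔄`, `A₁ + 𝔄 = A′`.
HONEST SCOPE.  Exact finite-dimensional algebra; the weak E–L equation (criticality of the charted Wilson functional on (157), extended to all of `ker Q` by the gauge
invariance along (125), p. 297) and the slice are HYPOTHESES (P5 ∕ P1); no estimate.  NOT a claim about the crux, the rung, or the mass gap.

References: T. Bałaban, CMP **102** (1985) 277–309 [Balaban1985Variational] (126)–(133) pp.297–298, (143) p.300, (157)–(158) p.302; CMP **96** (1984) 223–250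
[Balaban1984PropagatorsII] (2.19)–(2.22) p.226, (2.34)–(2.35) p.228.
-/

set_option autoImplicit false

noncomputable section

open scoped BigOperators InnerProductSpace Matrix.Norms.L2Operator

namespace Summit.QuantumFields.YangMills.Theorems.HalvingELDerivation

open Literature.MathematicalPhysics.QuantumFieldTheory.Balaban1983to89
open Literature.MathematicalPhysics.QuantumFieldTheory.BalabanImbrieJaffe1984to88.BIJ85AxialPropagator411 (BondSpace PlaqSpace)
open B6SectADomainsV1 (Domains)
open B6SectAOperatorsV1 (BondIdx BondIdxSpace QE QsE RE dsE dcE dcsE aE inner_QsE_left inner_dcsE_left QE_apply)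
open B6SectAVectorModelV1 (deltaAE GE EE inner_deltaAE_right)
open B6SectA (hOp)
open FlatCubeOperators (QE_hOp RE_dsE_hOp eq_Gt_of_ker)
open LatticeFieldCalculus (bondAvgIter)
open T3ContinuumYM3Torus (T3Family)
open FlatCubeOpsText (IsFlatGt)
open FlatOpsLettersAssembly (flatH)
open HalvingELJunction (QsE_EE_eq linear_kernel eq_of_forall_reFunctional RE_dsE_sub_hOp)

/-! ## §1 The derivation at the model level -/

section Model

variable {P : Params} (D : Domains P) {c : ℝ} (hc : c ≠ 0) {w : BondIdx D → ℝ} (hw : ∀ i, 0 < w i)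

/-- **`⟨∂δ, ∂(Hβ)⟩ = 0` FOR `Qδ = 0`** (print p. 298 «By the definition of H₀B and the condition QδA′ = 0 we have ⟨δA′, Δ_aH₀B⟩ = 0», with the `∂R∂*` and `Q*aQ` parts of
`Δ_a` removed by `R∂*H = 0` and `Qδ = 0`): from `∂*∂(Hβ) = Q*((QGQ*)⁻¹β − aβ)` (`HalvingELJunction.QsE_EE_eq`). [cite: Balaban1985Variational, (130) p.298; Balaban1984PropagatorsII, (2.34)-(2.35) p.228] -/
theorem inner_dcsE_dcE_hOp_eq_zero_of_ker {δ : BondSpace P} (hδ : QE D δ = 0) (β : BondIdxSpace D) :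
    ⟪dcE c δ, dcE c (hOp (GE D hc hw) (QsE D) (EE D hc hw) β)⟫_ℝ = 0 := by
  have h : dcsE c (dcE c (hOp (GE D hc hw) (QsE D) (EE D hc hw) β)) = QsE D (EE D hc hw β) - QsE D (aE D w β) :=
    eq_sub_of_add_eq (QsE_EE_eq D hc hw β).symm
  rw [real_inner_comm, ← inner_dcsE_left, h, ← map_sub, inner_QsE_left, hδ, inner_zero_right]

/-- **THE E–L DERIVATION (127) ⟹ (133)/(158) IN P2'S LETTERS**: if `⟨∂δ, ∂x′⟩ + ⟨δ, f⟩ = 0` for every `δ` with `Qδ = 0` (weak Euler–Lagrange on the constraint surface) and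
`R∂*x′ = 0` (the slice), then `x′ − H(Qx′) = −G̃f` — `A₀ := x′ − H₀(Qx′)` has `QA₀ = 0` and solves the weak `Δ_a`-equation with current `−f` on `ker Q`, which characterises
`G̃(−f)` (`FlatCubeOperators.eq_Gt_of_ker`). [cite: Balaban1985Variational, (127)-(133) pp.297-298, (143) p.300, (158) p.302] -/
theorem sub_hOp_eq_neg_Gt_of_weakEL {x' f : BondSpace P}
    (hEL : ∀ δ : BondSpace P, QE D δ = 0 → ⟪dcE c δ, dcE c x'⟫_ℝ + ⟪δ, f⟫_ℝ = 0) (hslice : RE D c (dsE c x') = 0) :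
    x' - hOp (GE D hc hw) (QsE D) (EE D hc hw) (QE D x') = -((GE D hc hw - hOp (GE D hc hw) (QsE D) (EE D hc hw) ∘ₗ QE D ∘ₗ GE D hc hw) f) := by
  have hQ : QE D (x' - hOp (GE D hc hw) (QsE D) (EE D hc hw) (QE D x')) = 0 := by rw [map_sub, QE_hOp, sub_self]
  have hR : RE D c (dsE c (x' - hOp (GE D hc hw) (QsE D) (EE D hc hw) (QE D x'))) = 0 := by rw [RE_dsE_sub_hOp D hc hw, hslice]
  rw [← map_neg]
  refine eq_Gt_of_ker D hc hw (-f) _ hQ fun δ hδ => ?_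
  rw [inner_deltaAE_right, hR, inner_zero_right, add_zero, hQ, map_zero, inner_zero_right, add_zero, map_sub, inner_sub_right,
    inner_dcsE_dcE_hOp_eq_zero_of_ker D hc hw hδ, sub_zero, inner_neg_right]
  linarith [hEL δ hδ]

end Model

/-! ## §2 The derivation for the `𝔤`-valued chart field at the T³ carrier -/

section Carrier

variable {F : T3Family} {n K : ℕ}

/-- **`Q` COMMUTES WITH REAL READINGS**: `Q(φ∘A′)(c) = φ((QA′)(c))` for the multi-scale block average of a matrix-valued field. [cite: Balaban1984PropagatorsI, (1.18) p.20; Balaban1984PropagatorsII, (2.20) p.226] -/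
theorem QE_reading (D : Domains (F.P K)) (φ : Matrix (Fin 2) (Fin 2) ℂ →ₗ[ℝ] ℝ) (A' : PBond (F.P K) 0 → Matrix (Fin 2) (Fin 2) ℂ) (c : BondIdx D) :
    QE D (WithLp.toLp 2 (fun b => φ (A' b))) c = φ (bondAvgIter (c.1.1 : ℕ) A' c.1.2) := by
  rw [QE_apply]
  exact ChartHInv.bondAvgIter_comp_apply φ (c.1.1 : ℕ) A' c.1.2

/-- **(158) FROM THE WEAK EULER–LAGRANGE EQUATION AND THE SLICE, FOR THE `𝔤`-VALUED CHART FIELD.**  At the T³ carrier, for EVERY nested family `D` and P2's pinned `H`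
(`flatH`) and `G̃` (`IsFlatGt`): if the chart field `A′` and the current `Wc = W(A′)` satisfy, for every `ℝ`-linear reading `φ` and every real test field `δ` with `Qδ = 0`,
`⟨∂δ, ∂(φ∘A′)⟩ + ⟨δ, φ∘Wc⟩ = 0` (weak E–L on the constraint surface — print's (127) at background 1) and `R∂*(φ∘A′) = 0` (the slice (126)/(153)), and if
`𝔄 = Σ_c (He_c)·(QA′)(c)` (the `HB` of (157), `B = QA′`) and `𝒢 = Σ_{b′} (G̃e_{b′})·Wc(b′)`, then `(A′ − 𝔄) + 𝒢 = 0` — i.e. `A₁ + G(W(A₁ + 𝔄)) = 0` with `A₁ := A′ − 𝔄`,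
the `hsol` of the (165)-A₁ row. [cite: Balaban1985Variational, (126)-(133) pp.297-298, (143) p.300, (157)-(158) p.302] -/
theorem sol158_of_weakEL (D : Domains (F.P K)) {Gt : (PBond (F.P K) 0 → ℝ) →ₗ[ℝ] (PBond (F.P K) 0 → ℝ)} (hGt : IsFlatGt F n K D Gt)
    {A' Wc 𝔄 𝒢 : PBond (F.P K) 0 → Matrix (Fin 2) (Fin 2) ℂ}
    (hEL : ∀ (φ : Matrix (Fin 2) (Fin 2) ℂ →ₗ[ℝ] ℝ) (δ : BondSpace (F.P K)), QE D δ = 0 →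
      ⟪dcE ((F.L : ℝ) ^ (K - n)) δ, dcE ((F.L : ℝ) ^ (K - n)) (WithLp.toLp 2 (fun b => φ (A' b)))⟫_ℝ + ⟪δ, WithLp.toLp 2 (fun b => φ (Wc b))⟫_ℝ = 0)
    (hslice : ∀ φ : Matrix (Fin 2) (Fin 2) ℂ →ₗ[ℝ] ℝ,
      RE D ((F.L : ℝ) ^ (K - n)) (dsE ((F.L : ℝ) ^ (K - n)) (WithLp.toLp 2 (fun b => φ (A' b)))) = 0)
    (h𝔄 : ∀ b, 𝔄 b = ∑ c, flatH F n K D (Pi.single c 1) b • bondAvgIter (c.1.1 : ℕ) A' c.1.2)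
    (h𝒢 : ∀ b, 𝒢 b = ∑ b', Gt (Pi.single b' 1) b • Wc b') :
    (A' - 𝔄) + 𝒢 = 0 := by
  have hc : ((F.L : ℝ) ^ (K - n)) ≠ 0 := pow_ne_zero _ (Nat.cast_ne_zero.2 (F.P K).L_pos.ne')
  funext b
  rw [Pi.add_apply, Pi.sub_apply, Pi.zero_apply]
  refine eq_of_forall_reFunctional fun fd u r => ?_
  -- the reading as an `ℝ`-linear functional
  let φ : Matrix (Fin 2) (Fin 2) ℂ →ₗ[ℝ] ℝ :=
    { toFun := fun M => r * (u * fd M).re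
      map_add' := fun M N => by simp only [map_add, mul_add, Complex.add_re]
      map_smul' := fun s M => by
        rw [ContinuousLinearMap.map_smul_of_tower, Complex.real_smul, mul_left_comm u, Complex.re_ofReal_mul, RingHom.id_apply, smul_eq_mul]
        ring }
  have hφ : ∀ M, φ M = r * (u * fd M).re := fun _ => rfl
  -- the model statement for the read fields
  have key := sub_hOp_eq_neg_Gt_of_weakEL D hc (fun _ => one_pos) (x' := WithLp.toLp 2 (fun b => φ (A' b)))
    (f := WithLp.toLp 2 (fun b => φ (Wc b))) (hEL φ) (hslice φ)
  -- read the three terms at `b`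
  have hQx : QE D (WithLp.toLp 2 (fun b => φ (A' b))) = WithLp.toLp 2 (fun c => φ (bondAvgIter (c.1.1 : ℕ) A' c.1.2)) := by
    ext c
    exact QE_reading D φ A' c
  have h𝔄φ : hOp (GE D hc (w := fun _ => (1 : ℝ)) (fun _ => one_pos)) (QsE D) (EE D hc (w := fun _ => (1 : ℝ)) (fun _ => one_pos))
      (QE D (WithLp.toLp 2 (fun b => φ (A' b)))) b = φ (𝔄 b) := by
    rw [hQx, linear_kernel (flatH F n K D) h𝔄 φ b]
    rfl
  have h𝒢φ : ((GE D hc (w := fun _ => (1 : ℝ)) (fun _ => one_pos) -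
      hOp (GE D hc (w := fun _ => (1 : ℝ)) (fun _ => one_pos)) (QsE D) (EE D hc (w := fun _ => (1 : ℝ)) (fun _ => one_pos)) ∘ₗ QE D ∘ₗ
        GE D hc (w := fun _ => (1 : ℝ)) (fun _ => one_pos)) (WithLp.toLp 2 (fun b' => φ (Wc b')))) b = φ (𝒢 b) := by
    rw [linear_kernel Gt h𝒢 φ b]
    exact (hGt (fun b' => φ (Wc b')) b).symm
  have keyb := congrArg (fun v : BondSpace (F.P K) => v b) key
  simp only [PiLp.sub_apply, PiLp.neg_apply] at keyb
  rw [h𝔄φ, h𝒢φ] at keyb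
  -- assemble
  rw [map_zero, mul_zero, Complex.zero_re, mul_zero, map_add, map_sub, mul_add, mul_sub, Complex.add_re, Complex.sub_re, mul_add, mul_sub,
    ← hφ, ← hφ, ← hφ]
  have hA : φ (A' b) = (WithLp.toLp 2 (fun b => φ (A' b)) : BondSpace (F.P K)) b := rfl
  rw [hA, keyb]
  ring

end Carrier

end Summit.QuantumFields.YangMills.Theorems.HalvingELDerivation

end
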